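import Summits.AtomisticToContinuum.Crystallization.Theorems.ChartedZeroExcessLayeredLatticeLiouvilleZH

/-!
# Part ZI «CombExtension» (lens-2 g78; step (L4-comb) of the (GL) plan, critic row 1388 (ii): "(L4-comb) FIRST — one configuration-free file")

The ABSTRACT EXTENSION THEOREM behind (GL) `BondLabelP` (NODE 77, tree `…LatticeLiouvilleZC`), configuration-free: no door set, no
crystal, no metric enters.  Data: two letter sequences `τS τC : ℤ → Bool` (source/target stackings), a coordinate region
`R ⊆ ℤ × ℤ × ℤ` (sheet; in-sheet Löschian coordinates) — in the application: the chart coordinates of the COOL atoms near `K` — and a map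
`f₀` on `R` that preserves the sheet index, preserves Barlow adjacency (`BarlowAdj`, tree ZH) and is injective (in the application: the REG-out
shell label of tree ZF read in two Barlow bond charts).

* ZI-1  the twelve point-group maps `loRot j ε` (tree ZD) are lattice AUTOMORPHISMS: injective, adjacency is reflected
  (`loAdj_affine_iff`), every neighbour of an image point is an image point (`exists_eq_affine_of_loAdj`).
* ZI-2  two local forcing lemmas completing tree ZD/ZE: `rhombus_forcing` (a site is pinned by an adjacent pair of pinned neighbours and
  the opposite common neighbour — the rule that pins RIM sites whose own stars are incomplete) and `floor_forcing` (a lower site is pinned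
  by the three upper sites it caps — the rule that pins POCKETS: cool sites enclosed, inside their sheet, by inner sites; such pockets exist
  for admissible `K`, e.g. `K` a ring of radius `q` and the sheet at height `≈ r`).
* ZI-3  the certificate calculus: `PinnedFlat` (in-sheet: closed stars of centres `StarAdj`-reachable from a base centre, closed under the
  rhombus rule) ⊆ `Pinned` (also closed under the two cap rules across consecutive sheets), and `Weld k` (a lattice triangle of sheet `k+1`
  flat-pinned together with its three lower triangles in sheet `k`).
* ZI-4  ★★★ `comb_extension` (PROVED): from the data above, base centres with closed stars in `R` on the sheets `kLo … kHi` and a weld between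
  consecutive ones, there is ONE map `F : ℤ × ℤ × ℤ → ℤ × ℤ × ℤ`, sheet-preserving, injective, point-group-AFFINE on every sheet, a Barlow
  homomorphism `τS → τC` on the sheets `kLo … kHi`, which AGREES WITH `f₀` ON EVERY PINNED SITE.  Ingredients: `lattice_rigidity_exists` (ZD) per
  sheet, `cap_forcing` + `affine_pinning` at the welds (the letters come out as `τC k = capType j ε (τS k)`), `crossAdj_lift` (ZE) for the
  cross bonds of `F`, ZI-2 for the closure rules.

The junction with (GL) — the typed pieces (L2-S) «the cool coordinates near `K` are pinned» and (L2-C) «the cool shadow crystal carries an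
S-adapted LINEAR Barlow bond chart» and `(GL) ⟸ (L2-S) ∧ (L2-C)` PROVED — is the sequel `…LatticeLiouvilleZJ`.
0 sorry; standard axioms.  Pure combinatorics.
-/

namespace Summit.AtomisticToContinuum.Crystallization.Theorems.ChartedZeroExcessLayeredLatticeLiouville

/-! ### ZI-1  The point-group maps are lattice automorphisms -/

/-- `loAdj_symm`. [formal bookkeeping] -/
theorem loAdj_symm {p q : ℤ × ℤ} (h : LoAdj p q) : LoAdj q p := by
  obtain ⟨k, rfl⟩ := h
  exact ⟨k + 3, by rw [add_assoc, loDir_add_three, add_zero]⟩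

/-- adjacency is translation invariant. [formal bookkeeping] -/
theorem loAdj_add_left_iff (c p q : ℤ × ℤ) : LoAdj (c + p) (c + q) ↔ LoAdj p q := by
  constructor
  · rintro ⟨k, hk⟩
    exact ⟨k, add_left_cancel (by rw [hk, add_assoc])⟩
  · rintro ⟨k, rfl⟩
    exact ⟨k, by rw [add_assoc]⟩

/-- the sum of two consecutive directions is not zero (a rhombus is not degenerate). [formal bookkeeping] -/
theorem loDir_add_loDir_succ_ne_zero (m : Fin 6) : loDir m + loDir (m + 1) ≠ 0 := by
  revert m; decide

/-- ★ the twelve point-group maps are injective. -/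
theorem loRot_injective (j : Fin 6) (ε : Bool) : Function.Injective (loRot j ε) := by
  intro p q h
  simp only [loRot, Prod.mk.injEq] at h
  obtain ⟨h1, h2⟩ := h
  fin_cases j <;> cases ε <;> simp [loDir] at h1 h2 <;> ext <;> omega

/-- every lattice direction is the image of a lattice direction. [formal bookkeeping] -/
theorem exists_loRot_loDir_eq (j : Fin 6) (ε : Bool) (k : Fin 6) : ∃ k' : Fin 6, loRot j ε (loDir k') = loDir k := by
  cases ε
  · exact ⟨j - k, by rw [loRot_loDir_false]; congr 1; abel⟩
  · exact ⟨k - j, by rw [loRot_loDir_true]; congr 1; abel⟩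

/-- ★ a point-group-affine map REFLECTS adjacency (it is a lattice automorphism, not only a homomorphism). -/
theorem loAdj_affine_iff (a : ℤ × ℤ) (j : Fin 6) (ε : Bool) (p q : ℤ × ℤ) :
    LoAdj (a + loRot j ε p) (a + loRot j ε q) ↔ LoAdj p q := by
  constructor
  · rintro ⟨k, hk⟩
    obtain ⟨k', hk'⟩ := exists_loRot_loDir_eq j ε k
    refine ⟨k', loRot_injective j ε ?_⟩
    rw [loRot_add, hk']
    exact add_left_cancel (by rw [hk, add_assoc])
  · intro h
    obtain ⟨k, hk⟩ := loAdj_loRot j ε h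
    exact ⟨k, by rw [hk, add_assoc]⟩

/-- every neighbour of an image point is an image point (of a neighbour). [formal bookkeeping] -/
theorem exists_eq_affine_of_loAdj (a : ℤ × ℤ) (j : Fin 6) (ε : Bool) (p z : ℤ × ℤ)
    (h : LoAdj (a + loRot j ε p) z) : ∃ q, z = a + loRot j ε q ∧ LoAdj p q := by
  obtain ⟨k, rfl⟩ := h
  obtain ⟨k', hk'⟩ := exists_loRot_loDir_eq j ε k
  exact ⟨p + loDir k', by rw [loRot_add, hk', add_assoc], k', rfl⟩

/-! ### ZI-2  Two local forcing lemmas: the rhombus rule and the floor rule -/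

/-- the two common neighbours of an adjacent pair `P + loDir n`, `P + loDir (n+1)` are `P` and the opposite vertex of the rhombus. -/
theorem common_nbrs (P z : ℤ × ℤ) (n : Fin 6) (h1 : LoAdj (P + loDir n) z) (h2 : LoAdj (P + loDir (n + 1)) z) :
    z = P ∨ z = P + loDir n + loDir (n + 1) := by
  obtain ⟨k₁, e₁⟩ := h1
  obtain ⟨k₂, e₂⟩ := h2
  have key : ∀ n k₁ k₂ : Fin 6, loDir n + loDir k₁ = loDir (n + 1) + loDir k₂ →
      loDir n + loDir k₁ = 0 ∨ loDir k₁ = loDir (n + 1) := by decide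
  have e : loDir n + loDir k₁ = loDir (n + 1) + loDir k₂ := by
    have h := e₁.symm.trans e₂
    rw [add_assoc, add_assoc] at h
    exact add_left_cancel h
  rcases key n k₁ k₂ e with h | h
  · left; rw [e₁, add_assoc, h, add_zero]
  · right; rw [e₁, h]

/-- ★ **RHOMBUS FORCING.**  In the image of a point-group-affine map: a site adjacent to the images of `q + loDir m` and `q + loDir (m+1)` and
different from the image of the opposite vertex `q + loDir m + loDir (m+1)` IS the image of `q`.  (Pins a site from an adjacent pinned pair plus the
opposite pinned vertex — no complete star around the site is needed.) -/
theorem rhombus_forcing (a q z : ℤ × ℤ) (j : Fin 6) (ε : Bool) (m : Fin 6)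
    (h1 : LoAdj (a + loRot j ε (q + loDir m)) z) (h2 : LoAdj (a + loRot j ε (q + loDir (m + 1))) z)
    (h3 : z ≠ a + loRot j ε (q + loDir m + loDir (m + 1))) : z = a + loRot j ε q := by
  obtain ⟨q', rfl, hq'⟩ := exists_eq_affine_of_loAdj a j ε _ z h1
  rw [loAdj_affine_iff] at h2
  rcases common_nbrs q q' m hq' h2 with rfl | rfl
  · rfl
  · exact absurd rfl h3

/-- ★ **FLOOR FORCING** (the cap lemma of tree ZE read downwards).  Upper sheet affine with the LIFTED parameters
(`a + capShift j ε τ`, `loRot j ε`; letters `capType j ε τ`); a lower site `y` capped by the images of the three upper sites `q - triVert τ i`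
above `q` is forced: `y = a + loRot j ε q`. -/
theorem floor_forcing (a q y : ℤ × ℤ) (j : Fin 6) (ε τ : Bool)
    (h : ∀ i : Fin 3, CrossAdj (capType j ε τ) y ((a + capShift j ε τ) + loRot j ε (q - triVert τ i))) :
    y = a + loRot j ε q := by
  have key : ∀ i₂ : Fin 3, ∃ i' : Fin 3,
      (y - (a + loRot j ε q)) + triVert (capType j ε τ) i₂ = triVert (capType j ε τ) i' := by
    intro i₂
    obtain ⟨i, hi⟩ := loRot_triVert' j ε τ i₂
    obtain ⟨i', hi'⟩ := h i
    refine ⟨i', ?_⟩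
    rw [loRot_sub, hi] at hi'
    rw [hi']; abel
  obtain ⟨hz, -⟩ := triVert_sub_triVert _ _ _ key
  rwa [sub_eq_zero] at hz

/-! ### ZI-3  Barlow adjacency by sheets; the certificate calculus -/

/-- same sheet: Löschian neighbours. [formal bookkeeping] -/
theorem loAdj_of_barlowAdj {τ : ℤ → Bool} {x y : ℤ × ℤ × ℤ} (h : BarlowAdj τ x y) (he : y.1 = x.1) : LoAdj x.2 y.2 := by
  rcases h with ⟨-, h⟩ | ⟨h1, -⟩ | ⟨h1, -⟩
  · exact h
  · exfalso; omega
  · exfalso; omega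

/-- one sheet up: the lower site caps the upper one across the lower sheet's letter. [formal bookkeeping] -/
theorem crossAdj_of_barlowAdj {τ : ℤ → Bool} {x y : ℤ × ℤ × ℤ} (h : BarlowAdj τ x y) (he : y.1 = x.1 + 1) :
    CrossAdj (τ x.1) x.2 y.2 := by
  rcases h with ⟨h1, -⟩ | ⟨-, h⟩ | ⟨h1, -⟩
  · exfalso; omega
  · exact h
  · exfalso; omega

/-- Barlow-adjacent sites lie in the same or in consecutive sheets. [formal bookkeeping] -/
theorem barlowAdj_sheets {τ : ℤ → Bool} {x y : ℤ × ℤ × ℤ} (h : BarlowAdj τ x y) : y.1 ≤ x.1 + 1 ∧ x.1 ≤ y.1 + 1 := by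
  rcases h with ⟨h1, -⟩ | ⟨h1, -⟩ | ⟨h1, -⟩ <;> constructor <;> omega

/-- the sheet-`k` slice of a coordinate region. -/
def slice (R : Set (ℤ × ℤ × ℤ)) (k : ℤ) : Set (ℤ × ℤ) := {q | (k, q) ∈ R}

/-- along a `StarAdj R`-path from a centre whose closed star lies in `R`, every closed star lies in `R`. [formal bookkeeping] -/
theorem loStar_subset_of_reach {Rk : Set (ℤ × ℤ)} {c₀ c : ℤ × ℤ} (h0 : loStar c₀ ⊆ Rk)
    (hc : Relation.ReflTransGen (StarAdj Rk) c₀ c) : loStar c ⊆ Rk := by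
  induction hc with
  | refl => exact h0
  | tail _ h _ => exact h.2.2

/-- **IN-SHEET PIN CERTIFICATES.**  `PinnedFlat R base kLo kHi (k, q)`: the site `q` of sheet `k ∈ [kLo, kHi]` lies in the closed star of a centre
`StarAdj (slice R k)`-reachable from the base centre `base k` (rule `star`, = the hypothesis of `lattice_rigidity`), or `q ∈ slice R k` and the three
outer vertices of one of its six rhombi are pinned (rule `rhombus`). -/
inductive PinnedFlat (R : Set (ℤ × ℤ × ℤ)) (base : ℤ → ℤ × ℤ) (kLo kHi : ℤ) : ℤ × ℤ × ℤ → Prop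
  | star (k : ℤ) (c q : ℤ × ℤ) (hk : kLo ≤ k ∧ k ≤ kHi)
      (hc : Relation.ReflTransGen (StarAdj (slice R k)) (base k) c) (hq : q ∈ loStar c) : PinnedFlat R base kLo kHi (k, q)
  | rhombus (k : ℤ) (q : ℤ × ℤ) (m : Fin 6) (hR : (k, q) ∈ R)
      (h₁ : PinnedFlat R base kLo kHi (k, q + loDir m)) (h₂ : PinnedFlat R base kLo kHi (k, q + loDir (m + 1)))
      (h₃ : PinnedFlat R base kLo kHi (k, q + loDir m + loDir (m + 1))) : PinnedFlat R base kLo kHi (k, q)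

/-- **PIN CERTIFICATES.**  `Pinned τ R base kLo kHi x`: in-sheet certificates, closed moreover under the two CAP RULES across consecutive sheets
`k, k+1 ∈ [kLo, kHi]` of the source stacking `τ`: an upper site in `R` is pinned by its three lower neighbours (`capAbove`), a lower site in `R` by
the three upper sites it caps (`capBelow`).  In the application every such certificate forces the value of the shell label. -/
inductive Pinned (τ : ℤ → Bool) (R : Set (ℤ × ℤ × ℤ)) (base : ℤ → ℤ × ℤ) (kLo kHi : ℤ) : ℤ × ℤ × ℤ → Prop
  | flat (x : ℤ × ℤ × ℤ) (h : PinnedFlat R base kLo kHi x) : Pinned τ R base kLo kHi x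
  | rhombus (k : ℤ) (q : ℤ × ℤ) (m : Fin 6) (hR : (k, q) ∈ R)
      (h₁ : Pinned τ R base kLo kHi (k, q + loDir m)) (h₂ : Pinned τ R base kLo kHi (k, q + loDir (m + 1)))
      (h₃ : Pinned τ R base kLo kHi (k, q + loDir m + loDir (m + 1))) : Pinned τ R base kLo kHi (k, q)
  | capAbove (k : ℤ) (q : ℤ × ℤ) (hk : kLo ≤ k ∧ k < kHi) (hR : (k + 1, q) ∈ R)
      (h : ∀ i : Fin 3, Pinned τ R base kLo kHi (k, q + triVert (τ k) i)) : Pinned τ R base kLo kHi (k + 1, q)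
  | capBelow (k : ℤ) (q : ℤ × ℤ) (hk : kLo ≤ k ∧ k < kHi) (hR : (k, q) ∈ R)
      (h : ∀ i : Fin 3, Pinned τ R base kLo kHi (k + 1, q - triVert (τ k) i)) : Pinned τ R base kLo kHi (k, q)

/-- **WELD** between sheets `k` and `k+1`: a lattice triangle `{t, t + loDir m, t + loDir (m+1)}` of sheet `k+1`, flat-pinned, each vertex with its
three lower neighbours (letter `τ k`) flat-pinned in sheet `k`.  (Three applications of `cap_forcing` + `affine_pinning` then identify the affine
maps of the two sheets as a sheet lift and the target letter as `capType`.) -/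
def Weld (τ : ℤ → Bool) (R : Set (ℤ × ℤ × ℤ)) (base : ℤ → ℤ × ℤ) (kLo kHi k : ℤ) : Prop :=
  ∃ (t : ℤ × ℤ) (m : Fin 6), ∀ v : ℤ × ℤ, (v = t ∨ v = t + loDir m ∨ v = t + loDir (m + 1)) →
    PinnedFlat R base kLo kHi (k + 1, v) ∧ ∀ i : Fin 3, PinnedFlat R base kLo kHi (k, v + triVert (τ k) i)

/-- pinned sites lie in the region. [formal bookkeeping] -/
theorem PinnedFlat.mem {R : Set (ℤ × ℤ × ℤ)} {base : ℤ → ℤ × ℤ} {kLo kHi : ℤ}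
    (hbase : ∀ k, kLo ≤ k → k ≤ kHi → loStar (base k) ⊆ slice R k) {x : ℤ × ℤ × ℤ}
    (h : PinnedFlat R base kLo kHi x) : x ∈ R := by
  induction h with
  | star k c q hk hc hq => exact loStar_subset_of_reach (hbase k hk.1 hk.2) hc hq
  | rhombus k q m hR => exact hR

/-- pinned sites lie in the region. [formal bookkeeping] -/
theorem Pinned.mem {τ : ℤ → Bool} {R : Set (ℤ × ℤ × ℤ)} {base : ℤ → ℤ × ℤ} {kLo kHi : ℤ}
    (hbase : ∀ k, kLo ≤ k → k ≤ kHi → loStar (base k) ⊆ slice R k) {x : ℤ × ℤ × ℤ}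
    (h : Pinned τ R base kLo kHi x) : x ∈ R := by
  induction h with
  | flat x h => exact h.mem hbase
  | rhombus k q m hR => exact hR
  | capAbove k q hk hR => exact hR
  | capBelow k q hk hR => exact hR

/-! ### ZI-4  ★★★ The extension theorem -/

/-- ★★★ **COMBINATORIAL EXTENSION (PROVED; step (L4-comb) of the (GL) plan).**  See the module docstring.  The map `F` is explicit: on sheet `k`
it is the point-group-affine map that `lattice_rigidity_exists` (tree ZD) attaches to `f₀` at the base centre `base k`; the welds make consecutive
sheets a sheet lift of each other (tree ZE), whence `F` is a Barlow homomorphism; every pin certificate is then discharged by `lattice_rigidity`,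
`rhombus_forcing`, `cap_forcing`, `floor_forcing`. -/
theorem comb_extension (τS τC : ℤ → Bool) (R : Set (ℤ × ℤ × ℤ)) (f₀ : ℤ × ℤ × ℤ → ℤ × ℤ × ℤ)
    (base : ℤ → ℤ × ℤ) (kLo kHi : ℤ)
    (hsh : ∀ x ∈ R, (f₀ x).1 = x.1)
    (hhom : ∀ x ∈ R, ∀ y ∈ R, BarlowAdj τS x y → BarlowAdj τC (f₀ x) (f₀ y))
    (hinj : Set.InjOn f₀ R)
    (hbase : ∀ k, kLo ≤ k → k ≤ kHi → loStar (base k) ⊆ slice R k)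
    (hweld : ∀ k, kLo ≤ k → k < kHi → Weld τS R base kLo kHi k) :
    ∃ F : ℤ × ℤ × ℤ → ℤ × ℤ × ℤ,
      (∀ x, (F x).1 = x.1) ∧ Function.Injective F ∧
      (∀ k, ∃ a : ℤ × ℤ, ∃ j : Fin 6, ∃ ε : Bool, ∀ q, F (k, q) = (k, a + loRot j ε q)) ∧
      (∀ x y, kLo ≤ x.1 → x.1 ≤ kHi → kLo ≤ y.1 → y.1 ≤ kHi → BarlowAdj τS x y → BarlowAdj τC (F x) (F y)) ∧
      (∀ x, Pinned τS R base kLo kHi x → F x = f₀ x) := by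
  -- the shell map read sheet by sheet
  set g : ℤ → ℤ × ℤ → ℤ × ℤ := fun k q => (f₀ (k, q)).2 with hg
  have hf₀ : ∀ k q, (k, q) ∈ R → f₀ (k, q) = (k, g k q) := fun k q h => Prod.ext (hsh _ h) rfl
  have hB : ∀ k, ∀ p ∈ slice R k, ∀ q ∈ slice R k, LoAdj p q → LoAdj (g k p) (g k q) := by
    intro k p hp q hq h
    have hb := hhom (k, p) hp (k, q) hq (Or.inl ⟨rfl, h⟩)
    rw [hf₀ k p hp, hf₀ k q hq] at hb
    have h' := loAdj_of_barlowAdj hb rfl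
    exact h'
  have hI : ∀ k, Set.InjOn (g k) (slice R k) := by
    intro k p hp q hq h
    have e : f₀ (k, p) = f₀ (k, q) := by rw [hf₀ k p hp, hf₀ k q hq, h]
    simpa using hinj hp hq e
  -- the per-sheet rigidity parameters
  have hpar : ∀ k, ∃ a : ℤ × ℤ, ∃ j : Fin 6, ∃ ε : Bool, (kLo ≤ k → k ≤ kHi →
      ∀ c, Relation.ReflTransGen (StarAdj (slice R k)) (base k) c → ∀ p ∈ loStar c, g k p = a + loRot j ε p) := by
    intro k
    by_cases hk : kLo ≤ k ∧ k ≤ kHi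
    · obtain ⟨a, j, ε, h⟩ := lattice_rigidity_exists (g k) (slice R k) (hB k) (hI k) (base k) (hbase k hk.1 hk.2)
      exact ⟨a, j, ε, fun _ _ => h⟩
    · exact ⟨0, 0, true, fun h1 h2 => absurd ⟨h1, h2⟩ hk⟩
  choose a j ε hA using hpar
  set F : ℤ × ℤ × ℤ → ℤ × ℤ × ℤ := fun x => (x.1, a x.1 + loRot (j x.1) (ε x.1) x.2) with hF
  have hFk : ∀ k q, F (k, q) = (k, a k + loRot (j k) (ε k) q) := fun k q => rfl
  -- injectivity
  have injF : Function.Injective F := by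
    rintro ⟨kx, p⟩ ⟨ky, q⟩ h
    rw [hFk, hFk, Prod.mk.injEq] at h
    obtain ⟨rfl, h2⟩ := h
    rw [loRot_injective _ _ (add_left_cancel h2)]
  -- the rhombus step (shared by the two calculi)
  have rhombusStep : ∀ k q (m : Fin 6), (k, q) ∈ R →
      (k, q + loDir m) ∈ R → (k, q + loDir (m + 1)) ∈ R → (k, q + loDir m + loDir (m + 1)) ∈ R →
      F (k, q + loDir m) = f₀ (k, q + loDir m) → F (k, q + loDir (m + 1)) = f₀ (k, q + loDir (m + 1)) →
      F (k, q + loDir m + loDir (m + 1)) = f₀ (k, q + loDir m + loDir (m + 1)) → F (k, q) = f₀ (k, q) := by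
    intro k q m hR h1 h2 h3 e1 e2 e3
    rw [hFk, hf₀ _ _ h1, Prod.mk.injEq] at e1
    rw [hFk, hf₀ _ _ h2, Prod.mk.injEq] at e2
    rw [hFk, hf₀ _ _ h3, Prod.mk.injEq] at e3
    rw [hFk, hf₀ _ _ hR, Prod.mk.injEq]
    refine ⟨rfl, (rhombus_forcing (a k) q (g k q) (j k) (ε k) m ?_ ?_ ?_).symm⟩
    · rw [e1.2]; exact loAdj_symm (hB k q hR _ h1 ⟨m, rfl⟩)
    · rw [e2.2]; exact loAdj_symm (hB k q hR _ h2 ⟨m + 1, rfl⟩)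
    · rw [e3.2]
      intro h
      have := hI k hR h3 h
      exact loDir_add_loDir_succ_ne_zero m (by
        have h' : q + (loDir m + loDir (m + 1)) = q + 0 := by rw [add_zero, ← add_assoc]; exact this.symm
        exact add_left_cancel h')
  -- soundness of the in-sheet certificates
  have flat : ∀ x, PinnedFlat R base kLo kHi x → F x = f₀ x := by
    intro x hx
    induction hx with
    | star k c q hk hc hq =>
      have hmem : (k, q) ∈ R := loStar_subset_of_reach (hbase k hk.1 hk.2) hc hq
      rw [hFk, hf₀ _ _ hmem, hA k hk.1 hk.2 c hc q hq]
    | rhombus k q m hR h₁ h₂ h₃ ih₁ ih₂ ih₃ =>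
      exact rhombusStep k q m hR (h₁.mem hbase) (h₂.mem hbase) (h₃.mem hbase) ih₁ ih₂ ih₃
  -- the welds: consecutive sheets are a sheet lift of each other, and the target letter is `capType`
  have weldRel : ∀ k, kLo ≤ k → k < kHi →
      τC k = capType (j k) (ε k) (τS k) ∧ a (k + 1) = a k + capShift (j k) (ε k) (τS k) ∧
        j (k + 1) = j k ∧ ε (k + 1) = ε k := by
    intro k hk1 hk2
    obtain ⟨t, m, hw⟩ := hweld k hk1 hk2
    have vert : ∀ v, (v = t ∨ v = t + loDir m ∨ v = t + loDir (m + 1)) →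
        τC k = capType (j k) (ε k) (τS k) ∧
        a (k + 1) + loRot (j (k + 1)) (ε (k + 1)) v = a k + capShift (j k) (ε k) (τS k) + loRot (j k) (ε k) v := by
      intro v hv
      obtain ⟨hup, hlow⟩ := hw v hv
      have memU : (k + 1, v) ∈ R := hup.mem hbase
      have eU : g (k + 1) v = a (k + 1) + loRot (j (k + 1)) (ε (k + 1)) v := by
        have h := flat _ hup
        rw [hFk, hf₀ _ _ memU, Prod.mk.injEq] at h
        exact h.2.symm
      have hcap := cap_forcing (a k) v (g (k + 1) v) (j k) (ε k) (τS k) (τC k) (fun i => by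
        have memL : (k, v + triVert (τS k) i) ∈ R := (hlow i).mem hbase
        have hb := hhom _ memL _ memU (Or.inr (Or.inl ⟨rfl, i, rfl⟩))
        have eL := flat _ (hlow i)
        rw [hFk] at eL
        rw [← eL, hf₀ _ _ memU] at hb
        exact crossAdj_of_barlowAdj hb rfl)
      exact ⟨hcap.1, by rw [← eU]; exact hcap.2⟩
    obtain ⟨hτ, h0⟩ := vert t (Or.inl rfl)
    obtain ⟨-, h1⟩ := vert _ (Or.inr (Or.inl rfl))
    obtain ⟨-, h2⟩ := vert _ (Or.inr (Or.inr rfl))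
    obtain ⟨ha, hj, hε⟩ := affine_pinning (a (k + 1)) (a k + capShift (j k) (ε k) (τS k)) t
      (j (k + 1)) (j k) (ε (k + 1)) (ε k) m h0 h1 h2
    exact ⟨hτ, ha, hj, hε⟩
  -- F is a Barlow homomorphism on the welded sheets
  have homF : ∀ x y, kLo ≤ x.1 → x.1 ≤ kHi → kLo ≤ y.1 → y.1 ≤ kHi →
      BarlowAdj τS x y → BarlowAdj τC (F x) (F y) := by
    rintro ⟨kx, p⟩ ⟨ky, q⟩ hx1 hx2 hy1 hy2 h
    simp only at hx1 hx2 hy1 hy2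
    rcases h with ⟨he, hl⟩ | ⟨he, hc⟩ | ⟨he, hc⟩
    · simp only at he
      subst he
      exact Or.inl ⟨rfl, (loAdj_affine_iff _ _ _ p q).2 hl⟩
    · simp only at he
      subst he
      obtain ⟨hτ, ha, hj, hε⟩ := weldRel kx hx1 (by omega)
      refine Or.inr (Or.inl ⟨rfl, ?_⟩)
      show CrossAdj (τC kx) (a kx + loRot (j kx) (ε kx) p) (a (kx + 1) + loRot (j (kx + 1)) (ε (kx + 1)) q)
      rw [ha, hj, hε, hτ]
      exact crossAdj_lift (a kx) p q (j kx) (ε kx) (τS kx) hc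
    · simp only at he
      subst he
      obtain ⟨hτ, ha, hj, hε⟩ := weldRel ky hy1 (by omega)
      refine Or.inr (Or.inr ⟨rfl, ?_⟩)
      show CrossAdj (τC ky) (a ky + loRot (j ky) (ε ky) q) (a (ky + 1) + loRot (j (ky + 1)) (ε (ky + 1)) p)
      rw [ha, hj, hε, hτ]
      exact crossAdj_lift (a ky) q p (j ky) (ε ky) (τS ky) hc
  -- soundness of all certificates
  have pinned : ∀ x, Pinned τS R base kLo kHi x → F x = f₀ x := by
    intro x hx
    induction hx with
    | flat x h => exact flat x h
    | rhombus k q m hR h₁ h₂ h₃ ih₁ ih₂ ih₃ =>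
      exact rhombusStep k q m hR (h₁.mem hbase) (h₂.mem hbase) (h₃.mem hbase) ih₁ ih₂ ih₃
    | capAbove k q hk hR h ih =>
      obtain ⟨hτ, ha, hj, hε⟩ := weldRel k hk.1 hk.2
      have hcap := cap_forcing (a k) q (g (k + 1) q) (j k) (ε k) (τS k) (τC k) (fun i => by
        have memL : (k, q + triVert (τS k) i) ∈ R := (h i).mem hbase
        have hb := hhom _ memL _ hR (Or.inr (Or.inl ⟨rfl, i, rfl⟩))
        have eL := ih i
        rw [hFk] at eL
        rw [← eL, hf₀ _ _ hR] at hb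
        exact crossAdj_of_barlowAdj hb rfl)
      rw [hFk, hf₀ _ _ hR, hcap.2, ha, hj, hε]
    | capBelow k q hk hR h ih =>
      obtain ⟨hτ, ha, hj, hε⟩ := weldRel k hk.1 hk.2
      have key := floor_forcing (a k) q (g k q) (j k) (ε k) (τS k) (fun i => by
        have memU : (k + 1, q - triVert (τS k) i) ∈ R := (h i).mem hbase
        have hb := hhom _ hR _ memU (Or.inr (Or.inl ⟨rfl, i, (sub_add_cancel q _).symm⟩))
        have eU := ih i
        rw [hFk, ha, hj, hε] at eU
        rw [← eU, hf₀ _ _ hR] at hb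
        have hc := crossAdj_of_barlowAdj hb rfl
        rwa [hτ] at hc)
      rw [hFk, hf₀ _ _ hR, key]
  exact ⟨F, fun x => rfl, injF, fun k => ⟨a k, j k, ε k, fun q => rfl⟩, homF, pinned⟩

end Summit.AtomisticToContinuum.Crystallization.Theorems.ChartedZeroExcessLayeredLatticeLiouville
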